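import Literature.NumberTheory.Sieve.BombieriFriedlanderIwaniecTheorem2
import Literature.NumberTheory.Sieve.BombieriFriedlanderIwaniecDispersionLemma7
import HarnessLib

/-!
# Bombieri–Friedlander–Iwaniec 1986: Theorem 2 from Lemma 1 (as printed — see the Erratum below)

Topic `Literature/NumberTheory/Sieve`.  The last step of the formalisation of §9 of
E. Bombieri, J. B. Friedlander, H. Iwaniec, *Primes in arithmetic progressions to large moduli*,
Acta Math. 156 (1986), 203–251: **Theorem 2** (§9, p. 230) — the named fact
`Literature.NumberTheory.Sieve.BombieriFriedlanderIwaniecTheorem2` of `…Dispersion` — from BFI's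
Lemma 1 (§2, p. 210 = Deshouillers–Iwaniec, Invent. Math. 70 (1982), Theorem 12), taken as the
hypothesis `BFI.Lemma1BoundFor BFI.plateau2 (5/4)` exactly as for Theorem 1
(`BombieriFriedlanderIwaniecTheorem1_of_lemma1`, `…Theorem1Assembly`) and Theorems 5, 5*
(`BombieriFriedlanderIwaniecTheorem5_of_lemma1`, `…Lemma6`).  Everything else is PROVED in the
tree: the dispersion §§3–7 (`…DispersionSmoothing/S3/S2/S2Uniform/S1/S1Rest/Sqfree/MainTerm`,
Theorem 0 (a) in `…DispersionProofs`), §9 (9.1)–(9.13) (`…DispersionSeparation`, `…DispersionB`,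
`…DispersionR1Second/Core/Bound`), the assembly of Theorem 2 from Lemma 7
(`BFI.BombieriFriedlanderIwaniecTheorem2_of_lemma7` of `…Theorem2`, with `…Theorem2Errors`,
`…Theorem2Numerics`, `…Theorem2R1`), and Lemma 7 from Lemma 1 (`BFI.lemma7_dispBm_of_lemma1` of
`…DispersionLemma7`).

* **`BombieriFriedlanderIwaniecTheorem2_of_lemma1`** — Theorem 2 from Lemma 1 for the weight `w ⊗ w`.
* `BombieriFriedlanderIwaniecTheorem2_of_lemma1'` — the same from the printed form of Lemma 1
  (all smooth compactly supported weights).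

No named facts are introduced; the file is sorry-free.

## Erratum (added after the tree's refutation of the printed Lemma 1) — the theorems below are VACUOUS

The hypothesis `BFI.Lemma1BoundFor BFI.plateau2 (5/4)` is BFI's Lemma 1 AS PRINTED in 1986 (and as
printed in Deshouillers–Iwaniec 1982, Theorem 12), whose last term reads `D²NRS⁻¹`.  That printed
statement is a known slip: E. Bombieri, J. B. Friedlander, H. Iwaniec, *Some corrections to an old
paper*, arXiv:1903.01371 (2019), §2 Lemma 2.1, replace `D²NRS⁻¹` by `D²NR` ("the follow-up of the
correction of the bound (9.11) of [DI]").  The tree PROVES that the printed form is false for the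
very weight used here: `BFI.L1R.not_lemma1BoundFor_plateau2 : ¬ BFI.Lemma1BoundFor BFI.plateau2 (5/4)`
(`…Lemma1Refutation`, Ramanujan-sum counterexample with `S → ∞`).  Consequently
`BombieriFriedlanderIwaniecTheorem2_of_lemma1` has an unsatisfiable hypothesis and proves nothing
about `BombieriFriedlanderIwaniecTheorem2`; likewise `BFI.lemma7_dispBm_of_lemma1`
(`…DispersionLemma7`).  The primed form `BombieriFriedlanderIwaniecTheorem2_of_lemma1'` quantifies
the misprinted bound over all smooth weights and is a fortiori vacuous.  (Theorem 2 itself is not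
affected: "The corrections do not affect the statements of any of the theorems in the paper",
loc. cit., Abstract; nor is the tree's proof of §9, which already works with characters to the
modulus `δ q₀ k` as in §3 of the corrections.)

The HONEST reductions of Theorem 2, all proved in the tree, are

* `BombieriFriedlanderIwaniecTheorem2_of_lemma1corr (h : BFI.Lemma1BoundCorrected BFI.plateau2 (5/4))`
  (`…Theorem10FromLemma1Corrected`) — from the corrected Lemma 1 (BFI 2019, Lemma 2.1) for `w ⊗ w`;
* `BFI.theorem2_of_k1Half (h : BFI.K1HalfFor BFI.plateau2 (5/4))` (same file) — from its `S = 1/2`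
  instance, the only instance the proof of Lemma 7 uses (`s = 1`; there the corrected last term
  `D²NR` is smaller than the misprinted `2D²NR`, so the machinery of `…DispersionLemma7` applies
  verbatim: `BFI.L7.blockB_le_of_K1half`, `BFI.lemma7_dispBm_of_K1half`);
* further, `BFI.lemma1BoundCorrected_plateau2_of_offdiag` (`…Lemma1Completion`) proves the
  completion step, the zero frequency (the corrected (9.11) of Deshouillers–Iwaniec) and the tails,
  so that what remains unproved for Theorem 2 is exactly the OFF-DIAGONAL bound for the complete
  Kloosterman sums `BFI.L1.Koff` — Deshouillers–Iwaniec's Theorem 12 proper (Kuznetsov's formula and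
  the spectral large sieve on `Γ₀(rs)∖ℍ`), in neither Mathlib nor the tree.

## References

* E. Bombieri, J. B. Friedlander, H. Iwaniec, *Some corrections to an old paper*, arXiv:1903.01371
  (2019), Abstract, §2 Lemma 2.1, §3. [BombieriFriedlanderIwaniec2019]
* E. Bombieri, J. B. Friedlander, H. Iwaniec, Acta Math. 156 (1986), 203–251, §9 Theorem 2
  p. 230, Lemma 7 p. 230; §2 Lemma 1 p. 210. [BombieriFriedlanderIwaniecActa1986]
* J.-M. Deshouillers, H. Iwaniec, Invent. Math. 70 (1982), 219–288, Theorem 12.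
-/

noncomputable section

open scoped ContDiff

namespace Literature.NumberTheory.Sieve

open BFI

/-- **BFI 1986, Theorem 2 (§9, p. 230) from Lemma 1** — i.e. from the Deshouillers–Iwaniec bound
for sums of Kloosterman sums in the form printed as BFI's Lemma 1 (§2, p. 210), here for the fixed
smooth weight `g₀ = w ⊗ w` (`BFI.plateau2`, supported in `[1/4, 5/4]²`) and the ranges
`C, D, N ≥ 1`, `R, S ≥ 1/2` (hypothesis `BFI.Lemma1BoundFor BFI.plateau2 (5/4)`).  PROVED: Lemma 7
from Lemma 1 (`BFI.lemma7_dispBm_of_lemma1`, `…DispersionLemma7`) and Theorem 2 from Lemma 7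
(`BFI.BombieriFriedlanderIwaniecTheorem2_of_lemma7`, `…Theorem2`).
**VACUOUS** (see the module docstring, Erratum): the hypothesis is the MISPRINTED Lemma 1 (last
term `D²NRS⁻¹`), refuted in the tree (`BFI.L1R.not_lemma1BoundFor_plateau2`); the valid reduction is
`BombieriFriedlanderIwaniecTheorem2_of_lemma1corr` / `BFI.theorem2_of_k1Half`
(`…Theorem10FromLemma1Corrected`), from the corrected Lemma 1 of BFI 2019, Lemma 2.1.
[cite: BombieriFriedlanderIwaniecActa1986, §9 Theorem 2 p. 230; §2 Lemma 1 p. 210] -/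
theorem BombieriFriedlanderIwaniecTheorem2_of_lemma1 (hLB : BFI.Lemma1BoundFor BFI.plateau2 (5 / 4)) :
    BombieriFriedlanderIwaniecTheorem2 :=
  BFI.BombieriFriedlanderIwaniecTheorem2_of_lemma7 (BFI.lemma7_dispBm_of_lemma1 hLB)

/-- **Theorem 2 from Lemma 1 quantified over all smooth weights** (the printed form of Lemma 1:
"Let `g₀(ξ, η)` be a smooth function with compact support in `ℝ⁺ × ℝ⁺` … the constant implied in
`≪` depending at most on `ε` and `g(ξ, η)`"; compact support in `ℝ⁺ × ℝ⁺` is rendered as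
support in a box `[a, b]²`, `0 < a ≤ b`).  **VACUOUS** (module docstring, Erratum): already the
instance `g₀ = w ⊗ w` of the hypothesis is false (`BFI.L1R.not_lemma1BoundFor_plateau2`); see
`BombieriFriedlanderIwaniecTheorem2_of_lemma1corr`. [cite: BombieriFriedlanderIwaniecActa1986, §2 Lemma 1 p. 210; §9 Theorem 2 p. 230] -/
theorem BombieriFriedlanderIwaniecTheorem2_of_lemma1'
    (h1 : ∀ g₀ : ℝ → ℝ → ℝ, ContDiff ℝ ∞ (fun p : ℝ × ℝ => g₀ p.1 p.2) →
      ∀ a b : ℝ, 0 < a → a ≤ b →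
        (∀ ξ η : ℝ, ¬ (ξ ∈ Set.Icc a b ∧ η ∈ Set.Icc a b) → g₀ ξ η = 0) →
          BFI.Lemma1BoundFor g₀ b) :
    BombieriFriedlanderIwaniecTheorem2 :=
  BFI.BombieriFriedlanderIwaniecTheorem2_of_lemma7 (BFI.lemma7_dispBm_of_lemma1' h1)

end Literature.NumberTheory.Sieve
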